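import Summits.QuantumFields.QCD.Theses.PauliWegnerSea
import Summits.QuantumFields.QCD.Theses.WilsonMobilityGap

/-!
# Crux `ChiralGluonicCompletion` (stmt-QuantumFields-17498) — proof-side definitions of line `Sketch`
# (card strongly-chiral-subsequence)

Packaged predicates of the registered skeleton `Cruxes/ChiralGluonicCompletion/Lines/Sketch.lean` (namespace
`Summit.QuantumFields.QCD.Theorems.StronglyChiralSubsequence`, skeleton sha deabc27c…, seat
prover-line-stmt-QuantumFields-17498-0, 2026-08-17), copied VERBATIM (bodies byte-identical) so that the registered stub
theorems `stub_goldstone`, `stub_latticeGap`, `stub_continuum` (all stated over `Hyp` / `ContinuumBody`) and the glue of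
the line can land under `Theorems/` by name and signature (`Cruxes/…` is not importable from `Theorems/`).  Nothing of the
route is restated: the clause texts (i)–(iv), PQFD are byte-identical copies of the hypothesis of
`PauliWegnerSea.ChiralGluonicCompletion` (= `WilsonMobilityGap.ChiralGluonicCompletion`, `crux_eq_wilsonMobilityGap`),
`crux_iff : ChiralGluonicCompletion ↔ ∀ N_f ∈ {2,3}, (∃ reg, Hyp N_f reg) → QCDOf N_f` and
`qcdOf_iff_body : QCDOf N_f ↔ ∃ reg, HasMassScaling ∧ IsChiralAtZero ∧ ∀ m > 0, Body` are `Iff.rfl`.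
* `ClauseI … ClauseIV`, `PQFD`, `PerMass := ((i) ∧ (ii) ∧ (iii) ∧ (iv)) ∧ PQFD`, `Hyp` — the hypothesis on ONE `reg`;
* `Body` — the matrix of `QCDOf` at a mass tuple; `ContinuumBody` — the same without the lattice-gap conjunct (the output
  shape of the continuum stub; the lattice gap is re-attached by the line's `body_of_parts` with `Δ := min`).
All are `abbrev`s (reducible), so anonymous constructors / `obtain` patterns see through them.
-/

noncomputable section

namespace Summit.QuantumFields.QCD.Theorems.StronglyChiralSubsequence

open MeasureTheory Filter Topology
open Literature.MathematicalPhysics.QuantumFieldTheory Literature.MathematicalPhysics.QuantumLattice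
  Literature.Probability.LatticeModels

/-! ## §0 The crux's hypothesis, packaged verbatim -/

/-- Clause (i) at the mass tuple `m`: the bare masses are eventually on the physical branch (verbatim). -/
abbrev ClauseI (Nf : ℕ) (reg : QCDRegularisation Nf) (m : Fin Nf → ℝ) : Prop :=
  ∀ f : Fin Nf, ∀ᶠ k in atTop, -1 < reg.mcrit k + reg.a k * m f / reg.Zm k

/-- Clause (ii) at `m`: phase-quenched fractional-moment decay of the quark propagator at a physical rate,
uniformly in the volume (verbatim). -/
abbrev ClauseII (Nf : ℕ) (reg : QCDRegularisation Nf) (m : Fin Nf → ℝ) : Prop :=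
  ∃ s δ C : ℝ, 0 < s ∧ s < 1 ∧ 0 < δ ∧ ∀ᶠ k in atTop, ∀ S : ℕ, reg.L k ≤ S → ∀ (f : Fin Nf) (v : Literature.Probability.LatticeModels.Site 4), v ∈ box 4 S → (∫ U : GaugeConfig 4 (2 * S + 1) (Matrix.specialUnitaryGroup (Fin 3) ℂ), ‖(diracMatrix U fun fl => reg.mcrit k + reg.a k * m fl / reg.Zm k).det‖ * (∑ a : Fin 3, ∑ i : Fin 4, ∑ b : Fin 3, ∑ j : Fin 4, ‖(diracMatrix U fun fl => reg.mcrit k + reg.a k * m fl / reg.Zm k)⁻¹ (quarkEquiv (f, (Torus.proj (2 * S + 1) 0, a, i))) (quarkEquiv (f, (Torus.proj (2 * S + 1) (v), b, j)))‖) ^ s ∂(wilsonMeasure (fundamentalRep (Fin 3)) (reg.β k))) / (∫ U : GaugeConfig 4 (2 * S + 1) (Matrix.specialUnitaryGroup (Fin 3) ℂ), ‖(diracMatrix U fun fl => reg.mcrit k + reg.a k * m fl / reg.Zm k).det‖ ∂(wilsonMeasure (fundamentalRep (Fin 3)) (reg.β k))) ≤ C * Real.exp (-(δ * (reg.a k *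 ‖v‖)))

/-- Clause (iii) at `m`: the phase-quenched fractional-moment LOWER bound along the time axis (verbatim). -/
abbrev ClauseIII (Nf : ℕ) (reg : QCDRegularisation Nf) (m : Fin Nf → ℝ) : Prop :=
  ∃ s c₀ C₁ p : ℝ, 0 < s ∧ s < 1 ∧ 0 < c₀ ∧ ∀ᶠ k in atTop, ∀ S : ℕ, reg.L k ≤ S → ∀ (f : Fin Nf) (n : ℕ), n ≤ S → c₀ * Real.exp (-(C₁ * (reg.a k * n) + p * Real.log (n + 1))) ≤ (∫ U : GaugeConfig 4 (2 * S + 1) (Matrix.specialUnitaryGroup (Fin 3) ℂ), ‖(diracMatrix U fun fl => reg.mcrit k + reg.a k * m fl / reg.Zm k).det‖ * (∑ a : Fin 3, ∑ i : Fin 4, ∑ b : Fin 3, ∑ j : Fin 4, ‖(diracMatrix U fun fl => reg.mcrit k + reg.a k * m fl / reg.Zm k)⁻¹ (quarkEquiv (f, (Torus.proj (2 * S + 1) 0, a, i))) (quarkEquiv (f, (Torus.proj (2 * S + 1) (Pi.single 0 (n : ℤ)), b, j)))‖) ^ s ∂(wilsonMeasure (fundamentalRep (Fin 3)) (reg.β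 k))) / (∫ U : GaugeConfig 4 (2 * S + 1) (Matrix.specialUnitaryGroup (Fin 3) ℂ), ‖(diracMatrix U fun fl => reg.mcrit k + reg.a k * m fl / reg.Zm k).det‖ ∂(wilsonMeasure (fundamentalRep (Fin 3)) (reg.β k)))

/-- Clause (iv) at `m`: sign coherence `≥ ½` of the Wilson determinant at the scheme's own torus (verbatim). -/
abbrev ClauseIV (Nf : ℕ) (reg : QCDRegularisation Nf) (m : Fin Nf → ℝ) : Prop :=
  ∀ᶠ k in atTop, (1 / 2 : ℝ) ≤ ‖∫ U : GaugeConfig 4 (2 * reg.L k + 1) (Matrix.specialUnitaryGroup (Fin 3) ℂ), (diracMatrix U fun fl => reg.mcrit k + reg.a k * m fl / reg.Zm k).det ∂(wilsonMeasure (fundamentalRep (Fin 3)) (reg.β k))‖ / (∫ U : GaugeConfig 4 (2 * reg.L k + 1) (Matrix.specialUnitaryGroup (Fin 3) ℂ), ‖(diracMatrix U fun fl => reg.mcrit k + reg.a k * m fl / reg.Zm k).det‖ ∂(wilsonMeasure (fundamentalRep (Fin 3)) (reg.β k)))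

/-- The conclusion of `PhaseQuenchedFlavourDecay` at `m`: flavour-charged phase-quenched decay at rate `δ' a_k`
(verbatim). -/
abbrev PQFD (Nf : ℕ) (reg : QCDRegularisation Nf) (m : Fin Nf → ℝ) : Prop :=
  ∃ δ' : ℝ, 0 < δ' ∧ ∀ (R R' : ℕ) (A : QCDLatticeObservable Nf R) (B : QCDLatticeObservable Nf R'), (∃ (f₀ : Fin Nf) (q : ℤ), q ≠ 0 ∧ ∀ (θ : ℝ) (U : LGConfig 4 (Matrix.specialUnitaryGroup (Fin 3) ℂ)), ExteriorAlgebra.map (LinearMap.pi fun w => (Sum.elim (fun i => if (boxQuarkEquiv.symm i).1 = f₀ then Complex.exp (-((θ : ℂ) * Complex.I)) else 1) (fun i => if (boxQuarkEquiv.symm i).1 = f₀ then Complex.exp ((θ : ℂ) * Complex.I) else 1) (ofLex w)) • LinearMap.proj w) (A.F U) = Complex.exp (((q : ℝ) * θ : ℝ) * Complex.I) • A.F U) → ∃ C' : ℝ, ∀ᶠ k in atTop, ∀ S : ℕ, reg.L k ≤ S → ∀ n : ℕ, n ≤ S → ‖(∫ U : GaugeConfig 4 (2 * S + 1) (Matrix.specialUnitaryGroup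 (Fin 3) ℂ), (‖(diracMatrix U fun fl => reg.mcrit k + reg.a k * m fl / reg.Zm k).det‖ : ℂ) * (fermiIntegral (A.onTorus (2 * S + 1) 0 U * B.onTorus (2 * S + 1) (Pi.single 0 (n : ℤ)) U * fermiBoltzmann U fun fl => reg.mcrit k + reg.a k * m fl / reg.Zm k) / fermiIntegral (fermiBoltzmann U fun fl => reg.mcrit k + reg.a k * m fl / reg.Zm k)) ∂(wilsonMeasure (fundamentalRep (Fin 3)) (reg.β k))) / (∫ U : GaugeConfig 4 (2 * S + 1) (Matrix.specialUnitaryGroup (Fin 3) ℂ), (‖(diracMatrix U fun fl => reg.mcrit k + reg.a k * m fl / reg.Zm k).det‖ : ℂ) ∂(wilsonMeasure (fundamentalRep (Fin 3)) (reg.β k)))‖ ≤ C' * Real.exp (-(δ' * (reg.a k * n)))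

/-- The per-mass package of the crux at `m`: `((i) ∧ (ii) ∧ (iii) ∧ (iv)) ∧ PQFD`, grouped exactly as in the route file. -/
abbrev PerMass (Nf : ℕ) (reg : QCDRegularisation Nf) (m : Fin Nf → ℝ) : Prop :=
  (ClauseI Nf reg m ∧ ClauseII Nf reg m ∧ ClauseIII Nf reg m ∧ ClauseIV Nf reg m) ∧ PQFD Nf reg m

/-- The crux's whole hypothesis on ONE regularisation: mass scaling, the chiral pin, asymptotic scaling, and the
per-mass package at every positive mass tuple. -/
abbrev Hyp (Nf : ℕ) (reg : QCDRegularisation Nf) : Prop :=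
  reg.HasMassScaling ∧ reg.IsChiralAtZero ∧ (reg.scheme 0 0 0).HasAsymptoticScaling ∧
    ∀ m : Fin Nf → ℝ, (∀ f, 0 < m f) → PerMass Nf reg m

/-- The crux is literally `∀ N_f ∈ {2,3}, (∃ reg, Hyp N_f reg) → QCDOf N_f` (definitional unfolding). -/
theorem crux_iff : Summit.QuantumFields.QCD.Theses.PauliWegnerSea.ChiralGluonicCompletion ↔ ∀ Nf : ℕ, Nf = 2 ∨ Nf = 3 → (∃ reg : QCDRegularisation Nf, Hyp Nf reg) → QCDOf Nf :=
  Iff.rfl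

/-- The two route copies of the crux are the same proposition. -/
theorem crux_eq_wilsonMobilityGap : Summit.QuantumFields.QCD.Theses.PauliWegnerSea.ChiralGluonicCompletion =
    Summit.QuantumFields.QCD.Theses.WilsonMobilityGap.ChiralGluonicCompletion :=
  rfl

/-- The matrix of `QCDOf` at the mass tuple `m` along `reg`: species renormalisations, OS data with `IsQCDAlong`,
non-trivial non-Gaussian glue, dynamical flavour-changing pseudoscalars, and ONE gap `Δ > 0` of `T` and of the
lattice theory (verbatim the body of `QCDOf` under `∀ m`). -/
abbrev Body (Nf : ℕ) (reg : QCDRegularisation Nf) (m : Fin Nf → ℝ) : Prop :=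
  ∃ (z shift : QCDField Nf → ℕ → ℝ) (T : OSData (QCDField Nf) 4), IsQCDAlong (reg.scheme m z shift) T ∧
    T.IsNontrivial QCDField.glue ∧ T.IsNonGaussian QCDField.glue ∧
      (∀ f g : Fin Nf, f ≠ g → T.IsNontrivial (QCDField.pseudoRe f g)) ∧
        ∃ Δ > 0, T.HasMassGap Δ ∧ (reg.scheme m z shift).HasLatticeMassGap Δ

/-- The CONTINUUM part of the matrix at `m` along `reg`: as `Body` without the lattice-gap conjunct. -/
abbrev ContinuumBody (Nf : ℕ) (reg : QCDRegularisation Nf) (m : Fin Nf → ℝ) : Prop :=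
  ∃ (z shift : QCDField Nf → ℕ → ℝ) (T : OSData (QCDField Nf) 4), IsQCDAlong (reg.scheme m z shift) T ∧
    T.IsNontrivial QCDField.glue ∧ T.IsNonGaussian QCDField.glue ∧
      (∀ f g : Fin Nf, f ≠ g → T.IsNontrivial (QCDField.pseudoRe f g)) ∧ ∃ Δ > 0, T.HasMassGap Δ

/-- `QCDOf` is `∃ reg, HasMassScaling ∧ IsChiralAtZero ∧ ∀ m > 0, Body` (definitional unfolding). -/
theorem qcdOf_iff_body (Nf : ℕ) : QCDOf Nf ↔ ∃ reg : QCDRegularisation Nf, reg.HasMassScaling ∧ reg.IsChiralAtZero ∧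
    ∀ m : Fin Nf → ℝ, (∀ f, 0 < m f) → Body Nf reg m :=
  Iff.rfl

end Summit.QuantumFields.QCD.Theorems.StronglyChiralSubsequence

end
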